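import Literature.NumberTheory.AdelicBaseChange.PadicTensorCompletionProofs
import Summits.BirchSwinnertonDyer.Rank1Residual.GaloisImage.KatoExpStarFiniteLevel
import HarnessLib

/-!
# Route `KimAtThreeKolyvagin` (W2), crux `KatoKuriharaPortThreeShared` (item 19560), registered stub
# `stub_fineKato` = ⟨C1⟩, clause (C1.c) = SAT₀: the rider's lattice `cycIntLattice p m` goes to
# `∏_w 𝒪_w` under the semi-local isomorphism `ℚ_p ⊗_ℚ ℚ(ζ_m) ≅ ∏_{w ∣ p} ℚ(ζ_m)_w`

Cell `bsd-addord`, seat `bsd-addord-w2-acc4` (gen 3); `--supports stmt-BirchSwinnertonDyer-19560`.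
Theorems only (no definition, no named fact, no `sorry`); nothing asserted about any curve.

WHAT.  Rider (ii) of `KatoExpStarFiniteLevelAt` (the (C1.c) clause of ⟨C1⟩) states its premise in the
semi-local algebra `ℚ_[p] ⊗[ℚ] CyclotomicField m ℚ` with the lattice
`cycIntLattice p m = ℤ_p⟨1 ⊗ ζ_m^j⟩` (`GaloisImage/KatoExpStarFiniteLevel.lean`; note its generators are the POWERS `(1 ⊗ ζ_m)^j` of the
tensor `1 ⊗ ζ_m`).  The SAT₀ argument
reads that premise prime by prime above `p` through the isomorphism
`Ψ : ℚ_[p] ⊗[ℚ] L ≃ₐ[ℚ] ∏_{w ∣ v_p} L_w` of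
`Literature/NumberTheory/AdelicBaseChange/PadicTensorCompletionProofs` (`exists_padicTensorAlgEquiv`;
Cassels–Fröhlich II (10.2) at `K = ℚ` in the `ℚ_[p]` currency).  This file supplies the one
cell-specific line: **`cycIntLattice p m` lies in the `ℤ_p`-span of the `1 ⊗ b`, `b ∈ 𝓞_{ℚ(ζ_m)}`**
(`ζ_m^j` is an algebraic integer), hence **every `Ψ` with the pure-tensor formula maps
`cycIntLattice p m` into `∏_w 𝒪_w`** (`padicTensor_mem_adicCompletionIntegers_of_mem_cycIntLattice`) —
so the premise `p^t·Λ_{0,r}(y) − s ⊗ 1 = p^{k+1}·l`, `l ∈ L_int(m)`, becomes, in each `L_w`,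
`Ψ(p^t Λ y)_w − e_p(s) ∈ p^{k+1}𝒪_w` (with `padicTensor_map_smul` for the scalars).
[cite: CasselsFrohlichANT1967, Ch. II §10 Theorem (10.2)]
[cite: Kim2022StructureSelmer, §3.4.1 and the proof of Thm. 3.13 (arXiv v3 pp. 26–27)]
-/

set_option autoImplicit false
-- the Theorems namespace of a single-conjunct summit repeats the summit name by design (D-0017)
set_option linter.dupNamespace false

noncomputable section

open scoped TensorProduct NumberField
open IsDedekindDomain NumberField
open Literature.NumberTheory.AdelicBaseChange
open Summit.BirchSwinnertonDyer.Rank1Residual.GaloisImage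

namespace Summit.BirchSwinnertonDyer.BirchSwinnertonDyer.Theorems.KimAtThreeFineKatoSemiLocalLattice

variable (p : ℕ) [Fact p.Prime] (m : ℕ) [NeZero m]

set_option backward.isDefEq.respectTransparency false in
/-- **`L_int(m) = ℤ_p⟨(1 ⊗ ζ_m)^j⟩` lies in the `ℤ_p`-span of `1 ⊗ 𝓞_{ℚ(ζ_m)}`** (`(1 ⊗ ζ)^j = 1 ⊗ ζ^j`
and `ζ_m^j` is an algebraic integer: `IsPrimitiveRoot.isIntegral`).
[cite: Kim2022StructureSelmer, §3.4.1 (the lattice ℤ_p ⊗ ℤ[ζ_n] in the proof of Thm. 3.13)] -/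
theorem cycIntLattice_le_span_ringOfIntegers :
    cycIntLattice p m ≤ Submodule.span ℤ_[p]
      (Set.range fun b : 𝓞 (CyclotomicField m ℚ) ↦ (1 : ℚ_[p]) ⊗ₜ[ℚ] (b : CyclotomicField m ℚ)) := by
  refine Submodule.span_le.mpr ?_
  rintro _ ⟨j, rfl⟩
  have hint : IsIntegral ℤ (IsCyclotomicExtension.zeta m ℚ (CyclotomicField m ℚ) ^ j) :=
    ((IsCyclotomicExtension.zeta_spec m ℚ (CyclotomicField m ℚ)).isIntegral (NeZero.pos m)).pow j
  dsimp only
  rw [Algebra.TensorProduct.tmul_pow, one_pow]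
  refine Submodule.subset_span ⟨IsIntegralClosure.mk' (𝓞 (CyclotomicField m ℚ)) _ hint, ?_⟩
  change (1 : ℚ_[p]) ⊗ₜ[ℚ] (algebraMap (𝓞 (CyclotomicField m ℚ)) (CyclotomicField m ℚ)
      (IsIntegralClosure.mk' (𝓞 (CyclotomicField m ℚ)) _ hint)) = _
  rw [IsIntegralClosure.algebraMap_mk']

/-- **Every semi-local isomorphism with the pure-tensor formula maps `cycIntLattice p m` into
`∏_w 𝒪_w`**: for a `ℚ`-algebra map `Ψ : ℚ_[p] ⊗[ℚ] ℚ(ζ_m) → ∏_{w ∣ v_p} ℚ(ζ_m)_w` with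
`Ψ(s ⊗ x)_w = x · e_p(s)` (as produced by `exists_padicTensorAlgEquiv`) and `l ∈ cycIntLattice p m`,
`Ψ l _w ∈ 𝒪_w` for every `w` — the integrality through which SAT₀ reads the premise of rider (ii)
of `KatoExpStarFiniteLevelAt` in each completion. [cite: CasselsFrohlichANT1967, Ch. II §10 Theorem (10.2)] -/
theorem padicTensor_mem_adicCompletionIntegers_of_mem_cycIntLattice
    (Ψ : ℚ_[p] ⊗[ℚ] CyclotomicField m ℚ →ₐ[ℚ]
      (Π w : ((Rat.HeightOneSpectrum.primesEquiv (R := 𝓞 ℚ)).symm ⟨p, Fact.out⟩).Extension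
        (𝓞 (CyclotomicField m ℚ)), w.1.adicCompletion (CyclotomicField m ℚ)))
    (hΨ : ∀ (s : ℚ_[p]) (x : CyclotomicField m ℚ)
      (w : ((Rat.HeightOneSpectrum.primesEquiv (R := 𝓞 ℚ)).symm ⟨p, Fact.out⟩).Extension
        (𝓞 (CyclotomicField m ℚ))),
      Ψ (s ⊗ₜ[ℚ] x) w = algebraMap (CyclotomicField m ℚ) (w.1.adicCompletion (CyclotomicField m ℚ)) x *
        algebraMap (((Rat.HeightOneSpectrum.primesEquiv (R := 𝓞 ℚ)).symm ⟨p, Fact.out⟩).adicCompletion ℚ)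
          (w.1.adicCompletion (CyclotomicField m ℚ)) (Padic.adicCompletionEquiv (𝓞 ℚ) ⟨p, Fact.out⟩ s))
    {l : ℚ_[p] ⊗[ℚ] CyclotomicField m ℚ} (hl : l ∈ cycIntLattice p m)
    (w : ((Rat.HeightOneSpectrum.primesEquiv (R := 𝓞 ℚ)).symm ⟨p, Fact.out⟩).Extension
      (𝓞 (CyclotomicField m ℚ))) :
    Ψ l w ∈ w.1.adicCompletionIntegers (CyclotomicField m ℚ) :=
  padicTensor_mem_adicCompletionIntegers_of_mem_span Ψ hΨ
    (cycIntLattice_le_span_ringOfIntegers p m hl) w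

end Summit.BirchSwinnertonDyer.BirchSwinnertonDyer.Theorems.KimAtThreeFineKatoSemiLocalLattice

end
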